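/-
Copyright (c) 2026 the pub-hodgecm-mathlib formalisation cell (harness21).  Prover seat hodgecm-mathlib-K2E2-p12 (g6): Track B «K2-LIT», ENGINE E1,
h413 = stmt-HodgeConjecture-24833; R8₂-sph ROAD T′, road (A) GELFAND, deal (144)(ii-b) of K2E1-plan (g7): `U(1,1)` — EVERY ELEMENT IS `K`-CONJUGATE TO ITS TRANSPOSE
(the geometric input of Gelfand's trick at the real places of `U(Φ₂)`, `N = 2`).
-/
import Literature.RepresentationTheory.KonnoKonno2007.UnitaryTwoOneOrbitalCommute   -- ★ `coe_kV_transpose`, ★ `RealUnitaryRankOneKAK` (KAK, `weylKV`), ★ `UpqMaximalCompactBlocks`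
import HarnessLib

/-!
# K2·E1 — `K2E1U11TransposeConjugate` (deal (144)(ii-b), road (A) GELFAND, `N = 2` archimedean places): IN `U(1,1) = UForm α β` (`|α| = |β| = 1`) EVERY `g` IS `K`-CONJUGATE TO `gᵀ`
# (`k g k⁻¹ = gᵀ`, `k ∈ K = U(1) × U(1)`), THE TRANSPOSE SELF-MAP, AND THE INVERSION AUTOMORPHISM OF `K` [Knapp Thm. 7.39; Helgason Ch. IV §3 Thm. 3.1]

Track B ∕ K2-LIT, crux h413 = `stmt-HodgeConjecture-24833`, route of record `HCCMUnconditional`; cell `hodgecm-mathlib`, squad K2, ENGINE E1 (R8₂-sph ROAD T′, road (A):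
(A3) ★ p859707 ← GLUING ★ p859808 ← (LOC)_∞ ★ p859855 `K2E1HeckeCommuteOfOrbitalU` ← ORBITAL commutativity ← «`σ z ∈ Ad(K) z`» = THIS FILE at `U(1,1)`; the `U(2,1)` case is ★
`UnitaryRankOneTransposeConjugate`).  KERNEL ONLY, THEOREMS ONLY (no `def`, no `instance`, no notation, no `sorry`; default heartbeats); lane
`--supports stmt-HodgeConjecture-24833 --as helper` (count-neutral).

THE GROUP: the real-rank-one unitary group `U(1,1) = UForm α β` of ★ `RealUnitaryDualPair` (`J = diag(1_α, −1_β)`) with `α`, `β` SINGLETONS, maximal compact `K = U(α) × U(β) ≅ U(1) × U(1)`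
(`UForm.kV`), planar boosts `a_t = hypV p₀ q₀ t` and Weyl element `w = weylKV p₀ = (diag(−1), 1)` of ★ `RealUnitaryRankOneKAK`.  WHAT IS SPECIAL AT RANK `(1,1)`: `K` is ABELIAN and
consists of SYMMETRIC (diagonal) matrices, so NO phase lemma is needed (contrast ★ `exists_kV_conj_eq_transpose` at `U(2,1)`):
* §1 `coe_hypV_transpose'` (`a_tᵀ = a_{−t}`, any rank; the ★ lemma is private), `transpose_unitaryGroup_of_subsingleton` (`zᵀ = z` in `U(1)`), `unitaryGroup_mul_comm_of_subsingleton`,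
  `kV_mul_comm_of_subsingleton` (`K` abelian), `coe_kV_transpose_of_subsingleton` (`(kV k)ᵀ = kV k`);
* §2 **`exists_kV_conj_eq_transpose_one_one`**: `g = k₁ a_t k₂` (★ KAK) ⇒ with `x := k₂ w k₁⁻¹ ∈ K`: `x g x⁻¹ = k₂ (w a_t w⁻¹) k₁ = k₂ a_{−t} k₁ = k₂ᵀ a_tᵀ k₁ᵀ = gᵀ` (abelian `K`);
* §3 **`exists_transposeMap_one_one`** — the transpose as a self-map `σ` of the carrier of `uFormGroup α β`: matrix `gᵀ`, anti-homomorphism, `σ g ∈ Ad(ιK K) g`;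
  **`exists_KV_invAut_of_subsingleton`** — the inversion `θ k = k⁻¹` as a `ContinuousMulEquiv` of the abelian `K` (so `σ (ιK k) = ιK k = (ιK (θ k))⁻¹`, the compatibility of ★
  `commute_orbitalOp_of_antiHom`).
The orbital∕Hecke-sandwich consequences ((LOC) at `U(1,1)`) are printed in `K2E1HeckeCommuteOfOrbitalU11`.
HONEST LABEL: HC_CM is proved only modulo the 7 printed citations (2 remaining named inputs: hLiu418 = `stmt-HodgeConjecture-24832`, h413 = `stmt-HodgeConjecture-24833`) until rung 0
closes; this file asserts no named fact and closes no socket; count-neutral; kernel facts about explicit matrix groups.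

## References
* [Knapp2002] A. W. Knapp, *Lie Groups Beyond an Introduction*, 2nd ed. (2002): Thm. 7.39 (`G = K A K`) — through ★ `RealUnitaryRankOneKAK`.
* [Helgason2000] S. Helgason, *Groups and Geometric Analysis*, AMS (2000): Ch. IV §3, Thm. 3.1 (Gelfand's lemma; the rôle of `σ g ∈ K g K` ∕ `Ad(K) g`).
-/

set_option autoImplicit false
set_option linter.dupNamespace false -- the mandated namespace repeats `HodgeConjecture.HodgeConjecture`

noncomputable section

open Matrix Complex
open scoped ComplexConjugate
open Literature.NumberTheory.Automorphic Literature.RepresentationTheory.BorelWallach2000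
open Literature.RepresentationTheory.KonnoKonno2007 Literature.RepresentationTheory.KonnoKonno2007.RealDualPair

namespace Summit.HodgeConjecture.HodgeConjecture.Cruxes.H413.K2E1U11TransposeConjugate

variable {α β : Type*} [Fintype α] [DecidableEq α] [Fintype β] [DecidableEq β]

/-! ## §1 Transposes of the `KAK` factors; `K = U(1) × U(1)` is abelian and symmetric -/

/-- **`a_tᵀ = a_{−t}`** (any rank): the planar boost `a_t = plant (cosh t, −i sinh t; i sinh t, cosh t)` is hermitian with imaginary corner, so transposition reverses it (the ★ lemma of
`UnitaryRankOneTransposeConjugate` is private; same computation). [cite: Knapp2002, Thm. 7.39] -/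
theorem coe_hypV_transpose' (p₀ : α) (q₀ : β) (t : ℝ) :
    ((((hypV p₀ q₀ t : UForm α β) : GL (α ⊕ β) ℂ) : Matrix (α ⊕ β) (α ⊕ β) ℂ))ᵀ =
      (((hypV p₀ q₀ (-t) : UForm α β) : GL (α ⊕ β) ℂ) : Matrix (α ⊕ β) (α ⊕ β) ℂ) := by
  ext i j
  rw [Matrix.transpose_apply]
  rcases i with a | b <;> rcases j with a' | b'
  · rw [hypV_inl_inl, hypV_inl_inl, Real.cosh_neg]
    by_cases ha : a = p₀
    · subst ha
      by_cases ha' : a' = a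
      · subst ha'; simp
      · simp [ha', Ne.symm ha']
    · by_cases ha' : a' = p₀
      · subst ha'; simp [ha, Ne.symm ha]
      · simp [ha, ha', eq_comm]
  · rw [hypV_inr_inl, hypV_inl_inr, Real.sinh_neg, Complex.ofReal_neg, neg_neg]
    simp only [and_comm]
  · rw [hypV_inl_inr, hypV_inr_inl, Real.sinh_neg, Complex.ofReal_neg, neg_mul]
    simp only [and_comm]
  · rw [hypV_inr_inr, hypV_inr_inr, Real.cosh_neg]
    by_cases hb : b = q₀
    · subst hb
      by_cases hb' : b' = b
      · subst hb'; simp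
      · simp [hb', Ne.symm hb']
    · by_cases hb' : b' = q₀
      · subst hb'; simp [hb, Ne.symm hb]
      · simp [hb, hb', eq_comm]

omit [Fintype β] [DecidableEq β] in
/-- In `U(γ)`, `|γ| ≤ 1`, transposition is the identity. [folklore] -/
theorem transpose_unitaryGroup_of_subsingleton {γ : Type*} [Fintype γ] [DecidableEq γ] [Subsingleton γ] (z : Matrix.unitaryGroup γ ℂ) :
    Matrix.UnitaryGroup.transpose z = z := by
  apply Subtype.ext
  ext i j
  rw [Matrix.UnitaryGroup.transpose_coe, Matrix.transpose_apply, Subsingleton.elim i j]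

omit [Fintype β] [DecidableEq β] in
/-- `U(γ)` is commutative for `|γ| ≤ 1`. [folklore] -/
theorem unitaryGroup_mul_comm_of_subsingleton {γ : Type*} [Fintype γ] [DecidableEq γ] [Subsingleton γ] (x y : Matrix.unitaryGroup γ ℂ) : x * y = y * x := by
  apply Subtype.ext
  change (x : Matrix γ γ ℂ) * (y : Matrix γ γ ℂ) = (y : Matrix γ γ ℂ) * (x : Matrix γ γ ℂ)
  ext i j
  have hj : j = i := Subsingleton.elim j i
  subst hj
  rw [Matrix.mul_apply, Matrix.mul_apply, Fintype.sum_subsingleton _ j, Fintype.sum_subsingleton _ j, mul_comm]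

/-- **`K = U(α) × U(β)` IS ABELIAN for `|α|, |β| ≤ 1`** (`U(1,1)`: `K ≅ U(1) × U(1)`). [folklore] -/
theorem kV_mul_comm_of_subsingleton [Subsingleton α] [Subsingleton β] (k k' : KV α β) : k * k' = k' * k :=
  Prod.ext (unitaryGroup_mul_comm_of_subsingleton k.1 k'.1) (unitaryGroup_mul_comm_of_subsingleton k.2 k'.2)

/-- **`(kV k)ᵀ = kV k`** for `|α|, |β| ≤ 1`: the compact elements of `U(1,1)` are diagonal, hence symmetric. [folklore] -/
theorem coe_kV_transpose_of_subsingleton [Subsingleton α] [Subsingleton β] (k : KV α β) :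
    ((((UForm.kV α β k : UForm α β) : GL (α ⊕ β) ℂ) : Matrix (α ⊕ β) (α ⊕ β) ℂ))ᵀ = (((UForm.kV α β k : UForm α β) : GL (α ⊕ β) ℂ) : Matrix (α ⊕ β) (α ⊕ β) ℂ) := by
  rw [coe_kV_transpose, transpose_unitaryGroup_of_subsingleton, transpose_unitaryGroup_of_subsingleton]

/-! ## §2 Every element of `U(1,1)` is `K`-conjugate to its transpose -/

/-- **`gᵀ ∈ Ad(K) g` in `U(1,1)`**: for every `g ∈ UForm α β` (`|α| = |β| = 1`) there is `k ∈ K = U(α) × U(β)` with `(kV k) g (kV k)⁻¹ = gᵀ` as matrices.  By ★ KAK `g = k₁ a_t k₂`; since `K` is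
abelian and symmetric and `w a_t w⁻¹ = a_{−t} = a_tᵀ` (★ `kV_weylKV_mul_hypV_mul_inv`), the element `x := k₂ w k₁⁻¹` does it: `x g x⁻¹ = k₂ (w a_t w⁻¹) k₁ = k₂ᵀ a_tᵀ k₁ᵀ = gᵀ`.  This is the
hypothesis «`σ g ∈ Ad(K) g`» of Gelfand's trick ★ `commute_orbitalOp_of_antiHom` for the transpose at `U(1,1)`. [cite: Knapp2002, Thm. 7.39] [cite: Helgason2000, Ch. IV §3 Thm. 3.1] -/
theorem exists_kV_conj_eq_transpose_one_one [Unique α] [Unique β] (g : UForm α β) :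
    ∃ k : KV α β,
      (((UForm.kV α β k * g * (UForm.kV α β k)⁻¹ : UForm α β) : GL (α ⊕ β) ℂ) : Matrix (α ⊕ β) (α ⊕ β) ℂ) =
        ((((g : UForm α β) : GL (α ⊕ β) ℂ) : Matrix (α ⊕ β) (α ⊕ β) ℂ))ᵀ := by
  -- `KAK` at the base indices `p₀ = default`, `q₀ = default`
  obtain ⟨k₁, k₂, t, -, hg⟩ := exists_kV_mul_hypV_mul_kV_eq (default : α) (default : β) g
  refine ⟨k₂ * weylKV (default : α) * k₁⁻¹, ?_⟩
  set K₁ : UForm α β := UForm.kV α β k₁ with hK₁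
  set K₂ : UForm α β := UForm.kV α β k₂ with hK₂
  set A : UForm α β := hypV (default : α) (default : β) t with hA
  set W : UForm α β := UForm.kV α β (weylKV (default : α)) with hW
  have hx : UForm.kV α β (k₂ * weylKV (default : α) * k₁⁻¹) = K₂ * W * K₁⁻¹ := by rw [map_mul, map_mul, map_inv]
  have hWA : W * A * W⁻¹ = hypV (default : α) (default : β) (-t) := kV_weylKV_mul_hypV_mul_inv (default : α) default t
  -- `K` is abelian: `k₂ k₁ w⁻¹ = w⁻¹ k₁ k₂`
  have hKc : K₂ * K₁ * W⁻¹ = W⁻¹ * K₁ * K₂ := by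
    rw [hK₁, hK₂, hW, ← map_inv, ← map_mul, ← map_mul, ← map_mul, ← map_mul, kV_mul_comm_of_subsingleton (k₂ * k₁),
      kV_mul_comm_of_subsingleton k₂ k₁, mul_assoc]
  -- group-level identity: `x g x⁻¹ = k₂ · a_{−t} · k₁`
  have key : UForm.kV α β (k₂ * weylKV (default : α) * k₁⁻¹) * g * (UForm.kV α β (k₂ * weylKV (default : α) * k₁⁻¹))⁻¹ =
      K₂ * hypV (default : α) (default : β) (-t) * K₁ := by
    rw [hx, hg, ← hWA]
    calc K₂ * W * K₁⁻¹ * (K₁ * A * K₂) * (K₂ * W * K₁⁻¹)⁻¹ = K₂ * W * A * (K₂ * K₁ * W⁻¹) * K₂⁻¹ := by group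
      _ = K₂ * W * A * (W⁻¹ * K₁ * K₂) * K₂⁻¹ := by rw [hKc]
      _ = K₂ * (W * A * W⁻¹) * K₁ := by group
  rw [key, UForm.coe_mul, UForm.coe_mul, hg, UForm.coe_mul, UForm.coe_mul, Matrix.transpose_mul, Matrix.transpose_mul,
    coe_kV_transpose_of_subsingleton, coe_kV_transpose_of_subsingleton, coe_hypV_transpose', Matrix.mul_assoc]

/-! ## §3 The transpose self-map of `U(1,1)` and the inversion automorphism of `K` -/

/-- **The transpose on `U(1,1)`**: a self-map `σ` of the carrier of `uFormGroup α β` (`|α| = |β| = 1`) whose value at `g` has matrix `gᵀ`; it is an anti-homomorphism, and every `σ g` is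
`ιK(K)`-conjugate to `g` (`ιK = incl ∘ upqMaximalCompactEquiv⁻¹`), by §2. [cite: Helgason2000, Ch. IV §3 Thm. 3.1] [cite: Knapp2002, Thm. 7.39] -/
theorem exists_transposeMap_one_one [Unique α] [Unique β] :
    ∃ σ : ↥(uFormGroup α β).carrier → ↥(uFormGroup α β).carrier,
      (∀ g, (((σ g : ↥(uFormGroup α β).carrier) : GL (α ⊕ β) ℂ) : Matrix (α ⊕ β) (α ⊕ β) ℂ) =
          ((((g : ↥(uFormGroup α β).carrier) : GL (α ⊕ β) ℂ) : Matrix (α ⊕ β) (α ⊕ β) ℂ))ᵀ) ∧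
      (∀ a b, σ (a * b) = σ b * σ a) ∧
      (∀ g, ∃ u : KV α β,
          σ g = Subgroup.inclusion (uFormGroup α β).maximalCompact_le_carrier (upqMaximalCompactEquiv.symm u) * g *
            (Subgroup.inclusion (uFormGroup α β).maximalCompact_le_carrier (upqMaximalCompactEquiv.symm u))⁻¹) := by
  classical
  let σ : ↥(uFormGroup α β).carrier → ↥(uFormGroup α β).carrier := fun g =>
    Subgroup.inclusion (uFormGroup α β).maximalCompact_le_carrier
        (upqMaximalCompactEquiv.symm (Classical.choose (exists_kV_conj_eq_transpose_one_one (α := α) (β := β) g))) * g *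
      (Subgroup.inclusion (uFormGroup α β).maximalCompact_le_carrier
        (upqMaximalCompactEquiv.symm (Classical.choose (exists_kV_conj_eq_transpose_one_one (α := α) (β := β) g))))⁻¹
  have hσ : ∀ g, (((σ g : ↥(uFormGroup α β).carrier) : GL (α ⊕ β) ℂ) : Matrix (α ⊕ β) (α ⊕ β) ℂ) =
      ((((g : ↥(uFormGroup α β).carrier) : GL (α ⊕ β) ℂ) : Matrix (α ⊕ β) (α ⊕ β) ℂ))ᵀ := fun g =>
    Classical.choose_spec (exists_kV_conj_eq_transpose_one_one (α := α) (β := β) g)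
  refine ⟨σ, hσ, fun a b => ?_, fun g => ⟨Classical.choose (exists_kV_conj_eq_transpose_one_one (α := α) (β := β) g), rfl⟩⟩
  apply Subtype.ext
  apply Units.ext
  rw [hσ, Subgroup.coe_mul, Units.val_mul, Matrix.transpose_mul, Subgroup.coe_mul, Units.val_mul, hσ, hσ]

/-- **The inversion automorphism `θ k = k⁻¹` of the ABELIAN compact group `K = U(α) × U(β)`** (`|α|, |β| ≤ 1`) as an isomorphism of topological groups — the `θ` of ★
`commute_orbitalOp_of_antiHom` at `U(1,1)`: since `(kV k)ᵀ = kV k`, the compatibility `σ (ιK k) = (ιK (θ k))⁻¹` reads `ιK k = (ιK k⁻¹)⁻¹`. [cite: Helgason2000, Ch. IV §3 Thm. 3.1] -/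
theorem exists_KV_invAut_of_subsingleton [Subsingleton α] [Subsingleton β] :
    ∃ θ : KV α β ≃ₜ* KV α β, ∀ k : KV α β, θ k = k⁻¹ :=
  ⟨{ toFun := fun k => k⁻¹
     invFun := fun k => k⁻¹
     left_inv := fun k => inv_inv k
     right_inv := fun k => inv_inv k
     map_mul' := fun k k' => by rw [_root_.mul_inv_rev, kV_mul_comm_of_subsingleton]
     continuous_toFun := continuous_inv
     continuous_invFun := continuous_inv }, fun _ => rfl⟩

end Summit.HodgeConjecture.HodgeConjecture.Cruxes.H413.K2E1U11TransposeConjugate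

end
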